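import Summits.CriticalPhenomena.PercolationContinuityZ3.Theses.PercNearOneGluing
import Summits.CriticalPhenomena.PercolationContinuityZ3.Theorems.PercNearOneGluingAdditiveGluingOffClusterAttach
import Summits.CriticalPhenomena.PercolationContinuityZ3.Theorems.PercNearOneGluingAdditiveGluingThreeClusterNegCorr
import Summits.CriticalPhenomena.PercolationContinuityZ3.Theorems.PercNearOneGluingAdditiveGluingK0CovTransferQOfSD
import Summits.CriticalPhenomena.PercolationContinuityZ3.Theorems.PercNearOneGluingAdditiveGluingTOfTD
import HarnessLib

/-!
# Crux `PercNearOneGluing.AdditiveGluing` (stmt-CriticalPhenomena-4576), line `tieline`: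
# the kernel (T) in the separated case `μ(D ∩ {u ↔ c}) = 0` — stub `stub_kernelT_separated_c13`

Support file (`--supports stmt-CriticalPhenomena-4576`, registered stub of line `tieline`, lead c13/c14).
No definitions, no named facts, no sorries.

Weighted graph on `Fin n` (`μ = prodBernoulli w`, arbitrary edge weights), relays `u, v`, target `b`, observer `o`,
spectator `c`; `D = {u ↮ v}`, `N = {c ↮ u} ∩ {c ↮ v}`, `C_v ω = openEdgeCluster ω v`.  The kernel of the three-relay
half of the crux (registered stub `stub_k0CovTransferQ_c9`, open in general) is
  (T)  `μ(D)·(μ(D∩ub∩vo)·μ(N) − μ(D∩ub∩vc)·μ(N∩oc)) ≤ μ(D∩ub)·(μ(D∩vo)·μ(N) − μ(D∩vc)·μ(N∩oc))`.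
This file proves (T) in the **separated case** `μ(D ∩ {u ↔ c}) = 0` ("on `D`, the spectator `c` never reaches the
first relay `u`"), following LeadMath-c13:

* `KernelTSeparated.sd_at` : under `μ(D ∩ {u↔c}) = 0`, the dominance statement (SD) holds at this tuple for every
  event `U` increasing in `C_v`:
  `μ(D∩N∩oc)·(μ(D)·μ(D∩U∩vc) − μ(D∩U)·μ(D∩vc)) ≤ μ(D∩N)·(μ(D)·μ(D∩U∩vo) − μ(D∩U)·μ(D∩vo))`.
  Ingredients: the A-step `stub_offClusterAttach_c13` (`U` and `M′ = {o↔v} ∪ ({o↔c} ∩ {c↮u})` positively correlated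
  given `D`), the B-step `stub_threeClusterNegCorr_c13` (`U` and `{o↔c}` negatively correlated given
  `T = {v↮u} ∩ {v↮c}`), the disjoint splitting `D ∩ M′ = (D ∩ {v↔o}) ⊔ (D ∩ N ∩ {o↔c})`, and the null-set identities
  `μ(T ∩ X) = μ(D ∩ N ∩ X)` (the difference lies in `D ∩ {u↔c}`); then three lines of real algebra.
* `KernelTSeparated.td_of_sd_at` : (SD at the tuple, all `U`) ⟹ (T_D at the tuple) — the proof of the landed
  `Theorems.covTransferD_of_SD` (domain Markov decomposition of `{u↔b}` over `C_v`, van den Berg–Häggström–Kahn display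
  (10): `K0CovTransferQOfSD.real_D_ub_eq`, `real_D_conn_ub_eq`, `compl_Vaux_mono`), which only uses (SD) at the same tuple.
* `KernelTSeparated.t_of_td_at` : (T_D at the tuple) ⟹ (T at the tuple) — the proof of the landed
  `TieLine.k0CovTransferQ_of_TD` ((γ″) = `stub_k0AttachTransferD_c10`, vdBHK negative correlation `TOfTD.negCorr`,
  Harris `TOfTD.harris_DN`, real algebra `TOfTD.alg`).
* `stub_kernelT_separated_c13` : the registered signature.
[cite: VandenbergHaggstromKahn2005, Thm. 1.3 (p. 6), Thm. 1.5 (p. 7), proof pp. 7–8 display (10)]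
[cite: KozmaNitzan2024, Lemma 4 (p. 9), Question 7 (p. 36)]
-/

namespace Summit.CriticalPhenomena.PercolationContinuityZ3.Cruxes.AdditiveGluing.TieLine

open MeasureTheory Set Literature.Probability.LatticeModels Literature.Probability.Percolation
open Summit.CriticalPhenomena.PercolationContinuityZ3.Theorems
open Literature.Probability.Percolation.BHK2006 (weight weight_nonneg)

noncomputable section

namespace KernelTSeparated

variable {n : ℕ}

/-! ### Set identities: splitting `M′` on `D`, and removing the null set `D ∩ {u ↔ c}` -/

/-- On `D = {u↮v}`: `D ∩ X ∩ ({o↔v} ∪ ({o↔c} ∩ {c↮u})) = (D ∩ X ∩ {v↔o}) ∪ (D ∩ N ∩ X ∩ {o↔c})`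
(`N = {c↮u} ∩ {c↮v}`; if `o ↔ c` and `c ↔ v` then `o ↔ v`). [folklore] -/
theorem D_X_M_eq (o u v c : Fin n) (X : Set (BondConfig (Fin n))) :
    ((openConn u v)ᶜ ∩ X ∩ (openConn o v ∪ (openConn o c ∩ (openConn c u)ᶜ)) : Set (BondConfig (Fin n))) =
      ((openConn u v)ᶜ ∩ X ∩ openConn v o) ∪
        ((openConn u v)ᶜ ∩ ((openConn c u)ᶜ ∩ (openConn c v)ᶜ) ∩ X ∩ openConn o c) := by
  ext ω
  simp only [mem_inter_iff, mem_union, mem_compl_iff, openConn, mem_setOf_eq]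
  constructor
  · rintro ⟨⟨huv, hX⟩, hov | ⟨hoc, hcu⟩⟩
    · exact Or.inl ⟨⟨huv, hX⟩, hov.symm⟩
    · by_cases hcv : (openGraph ω).Reachable c v
      · exact Or.inl ⟨⟨huv, hX⟩, (hoc.trans hcv).symm⟩
      · exact Or.inr ⟨⟨⟨huv, hcu, hcv⟩, hX⟩, hoc⟩
  · rintro (⟨⟨huv, hX⟩, hvo⟩ | ⟨⟨⟨huv, hcu, hcv⟩, hX⟩, hoc⟩)
    · exact ⟨⟨huv, hX⟩, Or.inl hvo.symm⟩
    · exact ⟨⟨huv, hX⟩, Or.inr ⟨hoc, hcu⟩⟩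

/-- The two pieces of `D_X_M_eq` are disjoint: `v ↔ o ↔ c` contradicts `c ↮ v`. [folklore] -/
theorem D_X_M_disjoint (o u v c : Fin n) (X : Set (BondConfig (Fin n))) :
    Disjoint ((openConn u v)ᶜ ∩ X ∩ openConn v o : Set (BondConfig (Fin n)))
      ((openConn u v)ᶜ ∩ ((openConn c u)ᶜ ∩ (openConn c v)ᶜ) ∩ X ∩ openConn o c) := by
  rw [Set.disjoint_left]
  rintro ω ⟨-, hvo⟩ ⟨⟨⟨-, -, hcv⟩, -⟩, hoc⟩
  exact hcv (SimpleGraph.Reachable.symm (SimpleGraph.Reachable.trans hvo hoc))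

/-- `μ(D ∩ X ∩ M′) = μ(D ∩ X ∩ {v↔o}) + μ(D ∩ N ∩ X ∩ {o↔c})` for `M′ = {o↔v} ∪ ({o↔c} ∩ {c↮u})`. [folklore] -/
theorem real_D_X_M_eq (w : Sym2 (Fin n) → unitInterval) (o u v c : Fin n) (X : Set (BondConfig (Fin n))) :
    (prodBernoulli w).real
        ((openConn u v)ᶜ ∩ X ∩ (openConn o v ∪ (openConn o c ∩ (openConn c u)ᶜ)) : Set (BondConfig (Fin n))) =
      (prodBernoulli w).real ((openConn u v)ᶜ ∩ X ∩ openConn v o : Set (BondConfig (Fin n))) +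
        (prodBernoulli w).real
          ((openConn u v)ᶜ ∩ ((openConn c u)ᶜ ∩ (openConn c v)ᶜ) ∩ X ∩ openConn o c : Set (BondConfig (Fin n))) := by
  rw [D_X_M_eq, measureReal_union (D_X_M_disjoint o u v c X) (Set.toFinite _).measurableSet]

/-- **Null-set identity of the separated case**: if `μ(D ∩ {u↔c}) = 0` then for every event `X`,
`μ(D ∩ {v↮c} ∩ X) = μ(D ∩ N ∩ X)` — the difference `D ∩ {v↮c} ∩ {c↔u} ∩ X` lies in the null set `D ∩ {u↔c}`.
[folklore] -/
theorem real_null_transfer (w : Sym2 (Fin n) → unitInterval) (u v c : Fin n)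
    (h0 : (prodBernoulli w).real ((openConn u v)ᶜ ∩ openConn u c : Set (BondConfig (Fin n))) = 0)
    (X : Set (BondConfig (Fin n))) :
    (prodBernoulli w).real ((openConn u v)ᶜ ∩ (openConn v c)ᶜ ∩ X : Set (BondConfig (Fin n))) =
      (prodBernoulli w).real
        ((openConn u v)ᶜ ∩ ((openConn c u)ᶜ ∩ (openConn c v)ᶜ) ∩ X : Set (BondConfig (Fin n))) := by
  apply le_antisymm
  · have hsub : ((openConn u v)ᶜ ∩ (openConn v c)ᶜ ∩ X : Set (BondConfig (Fin n))) ⊆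
        ((openConn u v)ᶜ ∩ ((openConn c u)ᶜ ∩ (openConn c v)ᶜ) ∩ X) ∪ ((openConn u v)ᶜ ∩ openConn u c) := by
      rintro ω ⟨⟨huv, hvc⟩, hX⟩
      by_cases hcu : (openGraph ω).Reachable c u
      · exact Or.inr ⟨huv, hcu.symm⟩
      · exact Or.inl ⟨⟨huv, hcu, fun hcv => hvc (SimpleGraph.Reachable.symm hcv)⟩, hX⟩
    calc (prodBernoulli w).real ((openConn u v)ᶜ ∩ (openConn v c)ᶜ ∩ X : Set (BondConfig (Fin n)))
        ≤ (prodBernoulli w).real (((openConn u v)ᶜ ∩ ((openConn c u)ᶜ ∩ (openConn c v)ᶜ) ∩ X) ∪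
            ((openConn u v)ᶜ ∩ openConn u c) : Set (BondConfig (Fin n))) := measureReal_mono hsub
      _ ≤ (prodBernoulli w).real
              ((openConn u v)ᶜ ∩ ((openConn c u)ᶜ ∩ (openConn c v)ᶜ) ∩ X : Set (BondConfig (Fin n))) +
            (prodBernoulli w).real ((openConn u v)ᶜ ∩ openConn u c : Set (BondConfig (Fin n))) :=
          measureReal_union_le _ _
      _ = _ := by rw [h0, add_zero]
  · exact measureReal_mono
      (fun ω ⟨⟨huv, hcu, hcv⟩, hX⟩ => ⟨⟨huv, fun hvc => hcv (SimpleGraph.Reachable.symm hvc)⟩, hX⟩)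

/-! ### (SD) at the tuple in the separated case -/

/-- **(SD) in the separated case.**  If `μ(D ∩ {u↔c}) = 0` then for every event `U` increasing in `C_v`:
`μ(D∩N∩oc)·(μ(D)·μ(D∩U∩vc) − μ(D∩U)·μ(D∩vc)) ≤ μ(D∩N)·(μ(D)·μ(D∩U∩vo) − μ(D∩U)·μ(D∩vo))`.
Proof: with `t = μ(D∩N)`, `tU, toc, tUoc` the masses of `D∩N∩U`, `D∩N∩oc`, `D∩N∩U∩oc` (equal to the corresponding
masses on `T = D ∩ {v↮c}` by `real_null_transfer`), the A-step `stub_offClusterAttach_c13` reads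
`μ(D∩U)·(μ(D∩vo) + toc) ≤ μ(D)·(μ(D∩U∩vo) + tUoc)` (`real_D_X_M_eq`), the B-step `stub_threeClusterNegCorr_c13` reads
`t·tUoc ≤ tU·toc`, and `μ(D∩U∩vc) = μ(D∩U) − tU`, `μ(D∩vc) = μ(D) − t`; the claim is `t·`(A-step) `+ μ(D)·`(B-step).
[cite: VandenbergHaggstromKahn2005, Thm. 1.3 (p. 6), Thm. 1.5 (pp. 7–8)] -/
theorem sd_at (w : Sym2 (Fin n) → unitInterval) (o u v c : Fin n)
    (h0 : (prodBernoulli w).real ((openConn u v)ᶜ ∩ openConn u c : Set (BondConfig (Fin n))) = 0)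
    (U : Set (BondConfig (Fin n)))
    (hU : ∀ ⦃ω ω' : BondConfig (Fin n)⦄, openEdgeCluster ω v ⊆ openEdgeCluster ω' v → ω ∈ U → ω' ∈ U) :
    (prodBernoulli w).real ((openConn u v)ᶜ ∩ ((openConn c u)ᶜ ∩ (openConn c v)ᶜ) ∩ openConn o c :
          Set (BondConfig (Fin n))) *
        ((prodBernoulli w).real ((openConn u v)ᶜ : Set (BondConfig (Fin n))) *
            (prodBernoulli w).real ((openConn u v)ᶜ ∩ U ∩ openConn v c : Set (BondConfig (Fin n))) -
          (prodBernoulli w).real ((openConn u v)ᶜ ∩ U : Set (BondConfig (Fin n))) *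
            (prodBernoulli w).real ((openConn u v)ᶜ ∩ openConn v c : Set (BondConfig (Fin n)))) ≤
      (prodBernoulli w).real ((openConn u v)ᶜ ∩ ((openConn c u)ᶜ ∩ (openConn c v)ᶜ) : Set (BondConfig (Fin n))) *
        ((prodBernoulli w).real ((openConn u v)ᶜ : Set (BondConfig (Fin n))) *
            (prodBernoulli w).real ((openConn u v)ᶜ ∩ U ∩ openConn v o : Set (BondConfig (Fin n))) -
          (prodBernoulli w).real ((openConn u v)ᶜ ∩ U : Set (BondConfig (Fin n))) *
            (prodBernoulli w).real ((openConn u v)ᶜ ∩ openConn v o : Set (BondConfig (Fin n)))) := by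
  -- A-step and B-step at `U`
  have hA := stub_offClusterAttach_c13 n w o u v c U hU
  have hB := stub_threeClusterNegCorr_c13 n w o u v c U hU
  rw [KNPreFKG.openConn_symm v u] at hB
  -- the A-step masses split along `D ∩ M′ = (D ∩ {v↔o}) ⊔ (D ∩ N ∩ {o↔c})`
  have hm := real_D_X_M_eq w o u v c univ
  simp only [inter_univ] at hm
  rw [hm, real_D_X_M_eq w o u v c U] at hA
  -- the B-step masses with the null set `D ∩ {u↔c}` removed
  have NT := real_null_transfer w u v c h0
  have e1 : (prodBernoulli w).real ((openConn u v)ᶜ ∩ (openConn v c)ᶜ : Set (BondConfig (Fin n))) =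
      (prodBernoulli w).real ((openConn u v)ᶜ ∩ ((openConn c u)ᶜ ∩ (openConn c v)ᶜ) : Set (BondConfig (Fin n))) := by
    simpa only [inter_univ] using NT univ
  have e4 : (prodBernoulli w).real ((openConn u v)ᶜ ∩ (openConn v c)ᶜ ∩ U ∩ openConn o c : Set (BondConfig (Fin n))) =
      (prodBernoulli w).real
        ((openConn u v)ᶜ ∩ ((openConn c u)ᶜ ∩ (openConn c v)ᶜ) ∩ U ∩ openConn o c : Set (BondConfig (Fin n))) := by
    rw [inter_assoc ((openConn u v)ᶜ ∩ (openConn v c)ᶜ) U (openConn o c), NT (U ∩ openConn o c),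
      ← inter_assoc ((openConn u v)ᶜ ∩ ((openConn c u)ᶜ ∩ (openConn c v)ᶜ)) U (openConn o c)]
  rw [e1, NT U, NT (openConn o c), e4] at hB
  -- complements: `μ(D∩U∩vc) = μ(D∩U) − μ(D∩N∩U)`, `μ(D∩vc) = μ(D) − μ(D∩N)`
  have c1 := ML5EdgeIdentity.real_eq_inter_add_inter_compl w ((openConn u v)ᶜ ∩ U : Set (BondConfig (Fin n)))
    (openConn v c)
  rw [inter_right_comm ((openConn u v)ᶜ) U ((openConn v c)ᶜ), NT U] at c1
  have c2 := ML5EdgeIdentity.real_eq_inter_add_inter_compl w ((openConn u v)ᶜ : Set (BondConfig (Fin n)))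
    (openConn v c)
  rw [e1] at c2
  rw [eq_sub_of_add_eq c1.symm, eq_sub_of_add_eq c2.symm]
  -- real algebra: `t·`(A-step) `+ μ(D)·`(B-step)
  have hd0 : 0 ≤ (prodBernoulli w).real ((openConn u v)ᶜ : Set (BondConfig (Fin n))) := measureReal_nonneg
  have ht0 : 0 ≤ (prodBernoulli w).real
      ((openConn u v)ᶜ ∩ ((openConn c u)ᶜ ∩ (openConn c v)ᶜ) : Set (BondConfig (Fin n))) := measureReal_nonneg
  have a1 := mul_le_mul_of_nonneg_left hA ht0
  have a2 := mul_le_mul_of_nonneg_left hB hd0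
  linarith

/-! ### (SD at the tuple) ⟹ (T_D at the tuple) ⟹ (T at the tuple) -/

/-- **(SD) ⟹ (T_D) at a fixed tuple** (the proof of `Theorems.covTransferD_of_SD`, which uses its hypothesis only at
the same `(n, w, o, u, v, c)`): if (SD) holds at `(n,w,o,u,v,c)` for every event `U` increasing in `C_v`, then
`μ(D∩N)·(μ(D)·μ(D∩ub∩vo) − μ(D∩ub)·μ(D∩vo)) ≤ μ(D∩N∩oc)·(μ(D)·μ(D∩ub∩vc) − μ(D∩ub)·μ(D∩vc))`.
Both covariances are `−Σ_η weight(η)·[the same with {u↔b} replaced by the C_v-increasing event U_η]`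
(`K0CovTransferQOfSD.real_D_conn_ub_eq`, `real_D_ub_eq`), so (T_D) is the `weight`-average of (SD) at `U = U_η`.
[cite: VandenbergHaggstromKahn2005, §1 pp. 7–8, display (10)] -/
theorem td_of_sd_at (w : Sym2 (Fin n) → unitInterval) (o b u v c : Fin n)
    (hSD : ∀ (U : Set (BondConfig (Fin n))),
      (∀ ⦃ω ω' : BondConfig (Fin n)⦄, openEdgeCluster ω v ⊆ openEdgeCluster ω' v → ω ∈ U → ω' ∈ U) →
      (prodBernoulli w).real ((openConn u v)ᶜ ∩ ((openConn c u)ᶜ ∩ (openConn c v)ᶜ) ∩ openConn o c :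
            Set (BondConfig (Fin n))) *
          ((prodBernoulli w).real ((openConn u v)ᶜ : Set (BondConfig (Fin n))) *
              (prodBernoulli w).real ((openConn u v)ᶜ ∩ U ∩ openConn v c : Set (BondConfig (Fin n))) -
            (prodBernoulli w).real ((openConn u v)ᶜ ∩ U : Set (BondConfig (Fin n))) *
              (prodBernoulli w).real ((openConn u v)ᶜ ∩ openConn v c : Set (BondConfig (Fin n)))) ≤
        (prodBernoulli w).real ((openConn u v)ᶜ ∩ ((openConn c u)ᶜ ∩ (openConn c v)ᶜ) : Set (BondConfig (Fin n))) *
          ((prodBernoulli w).real ((openConn u v)ᶜ : Set (BondConfig (Fin n))) *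
              (prodBernoulli w).real ((openConn u v)ᶜ ∩ U ∩ openConn v o : Set (BondConfig (Fin n))) -
            (prodBernoulli w).real ((openConn u v)ᶜ ∩ U : Set (BondConfig (Fin n))) *
              (prodBernoulli w).real ((openConn u v)ᶜ ∩ openConn v o : Set (BondConfig (Fin n))))) :
    (prodBernoulli w).real ((openConn u v)ᶜ ∩ ((openConn c u)ᶜ ∩ (openConn c v)ᶜ) : Set (BondConfig (Fin n))) *
        ((prodBernoulli w).real ((openConn u v)ᶜ : Set (BondConfig (Fin n))) *
            (prodBernoulli w).real ((openConn u v)ᶜ ∩ openConn u b ∩ openConn v o : Set (BondConfig (Fin n))) -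
          (prodBernoulli w).real ((openConn u v)ᶜ ∩ openConn u b : Set (BondConfig (Fin n))) *
            (prodBernoulli w).real ((openConn u v)ᶜ ∩ openConn v o : Set (BondConfig (Fin n)))) ≤
      (prodBernoulli w).real ((openConn u v)ᶜ ∩ ((openConn c u)ᶜ ∩ (openConn c v)ᶜ) ∩ openConn o c :
          Set (BondConfig (Fin n))) *
        ((prodBernoulli w).real ((openConn u v)ᶜ : Set (BondConfig (Fin n))) *
            (prodBernoulli w).real ((openConn u v)ᶜ ∩ openConn u b ∩ openConn v c : Set (BondConfig (Fin n))) -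
          (prodBernoulli w).real ((openConn u v)ᶜ ∩ openConn u b : Set (BondConfig (Fin n))) *
            (prodBernoulli w).real ((openConn u v)ᶜ ∩ openConn v c : Set (BondConfig (Fin n)))) := by
  -- adapted from `Theorems.covTransferD_of_SD` (PercNearOneGluingAdditiveGluingK0CovTransferQOfSD.lean)
  set μ := prodBernoulli w with hμ
  set w' : Sym2 (Fin n) → ℝ := fun e => (w e : ℝ) with hw'
  set d := μ.real ((openConn u v)ᶜ : Set (BondConfig (Fin n))) with hd
  set t := μ.real ((openConn u v)ᶜ ∩ ((openConn c u)ᶜ ∩ (openConn c v)ᶜ) : Set (BondConfig (Fin n))) with ht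
  set toc := μ.real ((openConn u v)ᶜ ∩ ((openConn c u)ᶜ ∩ (openConn c v)ᶜ) ∩ openConn o c : Set (BondConfig (Fin n)))
    with htoc
  set dvo := μ.real ((openConn u v)ᶜ ∩ openConn v o : Set (BondConfig (Fin n))) with hdvo
  set pc := μ.real ((openConn u v)ᶜ ∩ openConn v c : Set (BondConfig (Fin n))) with hpc
  -- per-η quantities
  set fU : Set (Sym2 (Fin n)) → ℝ := fun η => μ.real ((openConn u v)ᶜ ∩ ({ω' | b = u ∨ ∃ e ∈ openEdgeCluster (η \ {d | ∃ y ∈ d, y = v ∨ ∃ d' ∈ openEdgeCluster ω' v, y ∈ d'}) u, b ∈ e} : Set (BondConfig (Fin n)))ᶜ : Set (BondConfig (Fin n)))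
    with hfU
  set fUo : Set (Sym2 (Fin n)) → ℝ := fun η =>
    μ.real ((openConn u v)ᶜ ∩ ({ω' | b = u ∨ ∃ e ∈ openEdgeCluster (η \ {d | ∃ y ∈ d, y = v ∨ ∃ d' ∈ openEdgeCluster ω' v, y ∈ d'}) u, b ∈ e} : Set (BondConfig (Fin n)))ᶜ ∩ openConn v o : Set (BondConfig (Fin n))) with hfUo
  set fUc : Set (Sym2 (Fin n)) → ℝ := fun η =>
    μ.real ((openConn u v)ᶜ ∩ ({ω' | b = u ∨ ∃ e ∈ openEdgeCluster (η \ {d | ∃ y ∈ d, y = v ∨ ∃ d' ∈ openEdgeCluster ω' v, y ∈ d'}) u, b ∈ e} : Set (BondConfig (Fin n)))ᶜ ∩ openConn v c : Set (BondConfig (Fin n))) with hfUc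
  have hB : μ.real ((openConn u v)ᶜ ∩ openConn u b : Set (BondConfig (Fin n))) = ∑ η, weight w' η * (d - fU η) :=
    K0CovTransferQOfSD.real_D_ub_eq w b u v
  have hBo : μ.real ((openConn u v)ᶜ ∩ openConn u b ∩ openConn v o : Set (BondConfig (Fin n))) =
      ∑ η, weight w' η * (dvo - fUo η) := K0CovTransferQOfSD.real_D_conn_ub_eq w o b u v
  have hBc : μ.real ((openConn u v)ᶜ ∩ openConn u b ∩ openConn v c : Set (BondConfig (Fin n))) =
      ∑ η, weight w' η * (pc - fUc η) := K0CovTransferQOfSD.real_D_conn_ub_eq w c b u v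
  have hm : ∑ ω, weight w' ω = 1 := s1gen_sum_weight w
  -- (SD) at each `U_η`
  have hη : ∀ η, 0 ≤ weight w' η * (t * (d * fUo η - fU η * dvo) - toc * (d * fUc η - fU η * pc)) := by
    intro η
    refine mul_nonneg (weight_nonneg (fun e => (w e).2.1) (fun e => (w e).2.2) η) (sub_nonneg.2 ?_)
    exact hSD ({ω' | b = u ∨ ∃ e ∈ openEdgeCluster (η \ {d | ∃ y ∈ d, y = v ∨ ∃ d' ∈ openEdgeCluster ω' v, y ∈ d'}) u, b ∈ e} : Set (BondConfig (Fin n)))ᶜ (K0CovTransferQOfSD.compl_Vaux_mono u v b η)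
  have hsum := Finset.sum_nonneg fun η (_ : η ∈ Finset.univ) => hη η
  -- rewrite the goal as that sum
  rw [hB, hBo, hBc]
  have e1 : ∀ g : Set (Sym2 (Fin n)) → ℝ, ∀ a : ℝ,
      ∑ η, weight w' η * (a - g η) = a - ∑ η, weight w' η * g η := by
    intro g a
    simp only [mul_sub, Finset.sum_sub_distrib, ← Finset.sum_mul, hm, one_mul]
  have eR : ∑ η, weight w' η * (t * (d * fUo η - fU η * dvo) - toc * (d * fUc η - fU η * pc)) =
      t * d * (∑ η, weight w' η * fUo η) - t * dvo * (∑ η, weight w' η * fU η) -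
        toc * d * (∑ η, weight w' η * fUc η) + toc * pc * (∑ η, weight w' η * fU η) := by
    simp only [Finset.mul_sum, ← Finset.sum_sub_distrib, ← Finset.sum_add_distrib]
    refine Finset.sum_congr rfl fun η _ => ?_
    ring
  have expand : toc * (d * ∑ η, weight w' η * (pc - fUc η) - (∑ η, weight w' η * (d - fU η)) * pc) -
      t * (d * ∑ η, weight w' η * (dvo - fUo η) - (∑ η, weight w' η * (d - fU η)) * dvo) =
      ∑ η, weight w' η * (t * (d * fUo η - fU η * dvo) - toc * (d * fUc η - fU η * pc)) := by
    rw [e1 fUc pc, e1 fU d, e1 fUo dvo, eR]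
    ring
  linarith [expand, hsum]

open TOfTD in
/-- **(T_D) ⟹ (T) at a fixed tuple** (the proof of `TieLine.k0CovTransferQ_of_TD` at one tuple): from
`μ(D∩N)·(μ(D)·μ(D∩ub∩vo) − μ(D∩ub)·μ(D∩vo)) ≤ μ(D∩N∩oc)·(μ(D)·μ(D∩ub∩vc) − μ(D∩ub)·μ(D∩vc))`, the attachment transfer
(γ″) = `stub_k0AttachTransferD_c10` (`μ(D∩N)·μ(N∩oc) ≤ μ(D∩N∩oc)·μ(N)`), the vdBHK negative correlation
`μ(D)·μ(D∩ub∩vc) ≤ μ(D∩ub)·μ(D∩vc)` and Harris `μ(D)·μ(N) ≤ μ(D∩N)`, conclude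
(T) `μ(D)·(μ(D∩ub∩vo)·μ(N) − μ(D∩ub∩vc)·μ(N∩oc)) ≤ μ(D∩ub)·(μ(D∩vo)·μ(N) − μ(D∩vc)·μ(N∩oc))`.
[cite: VandenbergHaggstromKahn2005, Thm. 1.5 (p. 7)] -/
theorem t_of_td_at (w : Sym2 (Fin n) → unitInterval) (o b u v c : Fin n)
    (hTD : (prodBernoulli w).real ((openConn u v)ᶜ ∩ ((openConn c u)ᶜ ∩ (openConn c v)ᶜ) : Set (BondConfig (Fin n))) *
        ((prodBernoulli w).real ((openConn u v)ᶜ : Set (BondConfig (Fin n))) *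
            (prodBernoulli w).real ((openConn u v)ᶜ ∩ openConn u b ∩ openConn v o : Set (BondConfig (Fin n))) -
          (prodBernoulli w).real ((openConn u v)ᶜ ∩ openConn u b : Set (BondConfig (Fin n))) *
            (prodBernoulli w).real ((openConn u v)ᶜ ∩ openConn v o : Set (BondConfig (Fin n)))) ≤
      (prodBernoulli w).real ((openConn u v)ᶜ ∩ ((openConn c u)ᶜ ∩ (openConn c v)ᶜ) ∩ openConn o c :
          Set (BondConfig (Fin n))) *
        ((prodBernoulli w).real ((openConn u v)ᶜ : Set (BondConfig (Fin n))) *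
            (prodBernoulli w).real ((openConn u v)ᶜ ∩ openConn u b ∩ openConn v c : Set (BondConfig (Fin n))) -
          (prodBernoulli w).real ((openConn u v)ᶜ ∩ openConn u b : Set (BondConfig (Fin n))) *
            (prodBernoulli w).real ((openConn u v)ᶜ ∩ openConn v c : Set (BondConfig (Fin n))))) :
    (prodBernoulli w).real ((openConn u v)ᶜ : Set (BondConfig (Fin n))) *
        ((prodBernoulli w).real ((openConn u v)ᶜ ∩ openConn u b ∩ openConn v o : Set (BondConfig (Fin n))) *
            (prodBernoulli w).real ((openConn c u)ᶜ ∩ (openConn c v)ᶜ : Set (BondConfig (Fin n))) -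
          (prodBernoulli w).real ((openConn u v)ᶜ ∩ openConn u b ∩ openConn v c : Set (BondConfig (Fin n))) *
            (prodBernoulli w).real ((openConn c u)ᶜ ∩ (openConn c v)ᶜ ∩ openConn o c : Set (BondConfig (Fin n)))) ≤
      (prodBernoulli w).real ((openConn u v)ᶜ ∩ openConn u b : Set (BondConfig (Fin n))) *
        ((prodBernoulli w).real ((openConn u v)ᶜ ∩ openConn v o : Set (BondConfig (Fin n))) *
            (prodBernoulli w).real ((openConn c u)ᶜ ∩ (openConn c v)ᶜ : Set (BondConfig (Fin n))) -
          (prodBernoulli w).real ((openConn u v)ᶜ ∩ openConn v c : Set (BondConfig (Fin n))) *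
            (prodBernoulli w).real ((openConn c u)ᶜ ∩ (openConn c v)ᶜ ∩ openConn o c : Set (BondConfig (Fin n)))) := by
  -- adapted from `TieLine.k0CovTransferQ_of_TD` (PercNearOneGluingAdditiveGluingTOfTD.lean)
  by_cases huv : u = v
  · subst huv
    simp only [OffClusterAttach.notConn_self_eq_empty, empty_inter, measureReal_empty, zero_mul, le_refl]
  have hγ := stub_k0AttachTransferD_c10 n w o u v c
  have hX := negCorr w b u v c huv
  have hH := harris_DN w u v c
  rw [show ((openConn u v)ᶜ ∩ (openConn u b ∩ openConn v c) : Set (BondConfig (Fin n))) =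
      (openConn u v)ᶜ ∩ openConn u b ∩ openConn v c from (inter_assoc _ _ _).symm] at hX
  refine alg ?_ hγ (by linarith [hX]) hH measureReal_nonneg measureReal_nonneg measureReal_nonneg
    measureReal_nonneg measureReal_nonneg measureReal_nonneg
    (measureReal_mono inter_subset_left)
    (measureReal_mono (inter_subset_left.trans inter_subset_left)) (measureReal_mono inter_subset_left)
  linarith [hTD]

end KernelTSeparated

open KernelTSeparated in
/-- **The kernel (T) in the separated case** (line `tieline`, crux `AdditiveGluing`; registered stub
`stub_kernelT_separated_c13`, lead c13): with `D = {u↮v}`, `N = {c↮u} ∩ {c↮v}`, if `μ(D ∩ {u↔c}) = 0` (on `D` the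
spectator `c` reaches the first relay `u` only through the second relay `v`, i.e. never), then
`μ(D)·(μ(D∩ub∩vo)·μ(N) − μ(D∩ub∩vc)·μ(N∩oc)) ≤ μ(D∩ub)·(μ(D∩vo)·μ(N) − μ(D∩vc)·μ(N∩oc))`.
Proof: (SD at the tuple) (`sd_at`: A-step `stub_offClusterAttach_c13` + B-step `stub_threeClusterNegCorr_c13` + the
null-set identities) ⟹ (T_D at the tuple) (`td_of_sd_at`, domain Markov over `C_v`) ⟹ (T) (`t_of_td_at`).
[cite: VandenbergHaggstromKahn2005, Thm. 1.3 (p. 6), Thm. 1.5 (pp. 7–8)] [cite: KozmaNitzan2024, Question 7 (p. 36)] -/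
theorem stub_kernelT_separated_c13 : ∀ (n : ℕ) (w : Sym2 (Fin n) → unitInterval) (o b u v c : Fin n), (Literature.Probability.LatticeModels.prodBernoulli w).real ((Literature.Probability.Percolation.openConn u v)ᶜ ∩ Literature.Probability.Percolation.openConn u c : Set (Literature.Probability.Percolation.BondConfig (Fin n))) = 0 → (Literature.Probability.LatticeModels.prodBernoulli w).real ((Literature.Probability.Percolation.openConn u v)ᶜ : Set (Literature.Probability.Percolation.BondConfig (Fin n))) * ((Literature.Probability.LatticeModels.prodBernoulli w).real ((Literature.Probability.Percolation.openConn u v)ᶜ ∩ Literature.Probability.Percolation.openConn u b ∩ Literature.Probability.Percolation.openConn v o : Set (Literature.Probability.Percolation.BondConfig (Fin n))) * (Literature.Probability.LatticeModels.prodBernoulli w).real ((Literature.Probability.Percolation.openConn c u)ᶜ ∩ (Literature.Probability.Percolation.openConn c v)ᶜ : Set (Literature.Probability.Percolation.BondConfig (Fin n))) - (Literature.Probability.LatticeModels.prodBernoulli w).real ((Literature.Probability.Percolation.openConn u v)ᶜ ∩ Literature.Probability.Percolation.openConn u b ∩ Literature.Probability.Percolation.openConn v c : Set (Literature.Probability.Percolation.BondConfig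 (Fin n))) * (Literature.Probability.LatticeModels.prodBernoulli w).real ((Literature.Probability.Percolation.openConn c u)ᶜ ∩ (Literature.Probability.Percolation.openConn c v)ᶜ ∩ Literature.Probability.Percolation.openConn o c : Set (Literature.Probability.Percolation.BondConfig (Fin n)))) ≤ (Literature.Probability.LatticeModels.prodBernoulli w).real ((Literature.Probability.Percolation.openConn u v)ᶜ ∩ Literature.Probability.Percolation.openConn u b : Set (Literature.Probability.Percolation.BondConfig (Fin n))) * ((Literature.Probability.LatticeModels.prodBernoulli w).real ((Literature.Probability.Percolation.openConn u v)ᶜ ∩ Literature.Probability.Percolation.openConn v o : Set (Literature.Probability.Percolation.BondConfig (Fin n))) * (Literature.Probability.LatticeModels.prodBernoulli w).real ((Literature.Probability.Percolation.openConn c u)ᶜ ∩ (Literature.Probability.Percolation.openConn c v)ᶜ : Set (Literature.Probability.Percolation.BondConfig (Fin n))) - (Literature.Probability.LatticeModels.prodBernoulli w).real ((Literature.Probability.Percolation.openConn u v)ᶜ ∩ Literature.Probability.Percolation.openConn v c : Set (Literature.Probability.Percolation.BondConfig (Fin n))) * (Literature.Probability.LatticeModels.prodBernoulli w).real ((Literature.Probability.Percolation.openConn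 c u)ᶜ ∩ (Literature.Probability.Percolation.openConn c v)ᶜ ∩ Literature.Probability.Percolation.openConn o c : Set (Literature.Probability.Percolation.BondConfig (Fin n)))) := by
  intro n w o b u v c h0
  exact t_of_td_at w o b u v c (td_of_sd_at w o b u v c (sd_at w o u v c h0))

end

end Summit.CriticalPhenomena.PercolationContinuityZ3.Cruxes.AdditiveGluing.TieLine
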